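import Literature.NumberTheory.IwasawaTheory.ZpTowerFiniteOfLayerCardBound
import Literature.NumberTheory.NumberFields.UnramifiedOutsidePHomsKummerBound
import Literature.NumberTheory.EllipticCurves.ZpExtensionUnramifiedProofs
import HarnessLib

/-!
# The classes of `H¹(Gal(K̄/K_∞), M)` unramified outside `p` are FINITE, given at each layer of the `ℤ_p`-tower a totally
# real fixed field with a CM extension whose Kummer–reflection invariants grow linearly (Greenberg, LNM 1716, proof of
# Lemma 5.9, generic tower step; proved, no definition, no named fact)

`Proofs`-style file in topic `NumberTheory/IwasawaTheory` (namespace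
`Literature.NumberTheory.IwasawaTheory.UnramifiedOutsidePTowerFinite`), written by the prover seat `bsd-eis-lam-a` g20
(cell `bsd-eis`; `--supports` stmt-BirchSwinnertonDyer-19035, crux 5 `MazurMCOnX1RankZero`, registered stub `stub_publishedL59` =
Greenberg's Lemma 5.9; closes nothing).  It assembles, for an ARBITRARY number field `K` and `ℤ_p`-extension `κ` (`p` odd),
the bricks of the seat's discharge of Lemma 5.9 modulo Ferrero–Washington:

* the generic tower criterion `ZpTowerFiniteOfLayerCardBound.finite_of_card_fixedBy_le_pow` (classes of a `conj_γ`-stable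
  `p`-torsion subgroup fixed by `γ^{pⁿ}` bounded by `p^{an+b}` ⟹ finite);
* Greenberg's Lemma 3.2 (`ZpExtension.mem_range_resOfLe_of_conjH1_eq`: a class fixed by `γ^{pⁿ}` extends to `Gal(K̄/K_n)`);
* the injectivity of restriction to a subgroup of index prime to `p` acting trivially
  (`ZpTowerFiniteOfLayerCardBound.resOfLe_injective_of_index_coprime`);
* the Kummer–reflection count `UnramifiedOutsidePHomsKummerBound.card_le_pow_of_inertia_away`.

**Theorem** (`finite_unramifiedOutside_of_layerData`).  Let `M` be a finite discrete `Γ_K`-module with continuous action,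
`p·M = 0`, `#M = p^{k₀}`; for every `n` let `U_n ≤ Gal(K̄/K_n)` be an open normal subgroup of `Γ_K` acting trivially on
`M`, of index in `Gal(K̄/K_n)` prime to `p`, and `L_n` a CM number field containing a primitive `p`-th root of unity
with a ring isomorphism `F_n ≃ L_n⁺` from the fixed field `F_n` of `U_n` onto its maximal real subfield, such that `1 + s(L_n) + v_p #(Cl_{L_n}[p] ∩ ker N) ≤ a n + b` for `n ≥ n₀`
(`s` = number of primes above `p`).  Then the subgroup of `H¹(Gal(K̄/K_∞), M)` of classes unramified, with all their
conjugates, at every place not above `p` (`GreenbergVatsal2000.unramifiedOutside (ker κ) M p ∅`) is finite.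
(For `K = ℚ`, `κ` cyclotomic, `M = Θ` even of order `p`, `U_n = Gal(ℚ̄/ℚ_n(Θ, ζ_p)⁺)`, `L_n = ℚ_n(Θ, ζ_p)` and
Ferrero–Washington for the abelian field `ℚ(Θ, ζ_p)` this is Lemma 5.9.)

References: [GreenbergLNM1716] §1, §3 Lemma 3.2, §5 Lemma 5.9 (proof, pp. 142–144); [Washington1997] §13.3 and Prop. 13.2;
[SerreGaloisCohomology1997] I §2.6 (b).
-/

set_option autoImplicit false

noncomputable section

open scoped Classical Pointwise NumberField
open NumberField IsDedekindDomain Field IntermediateField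

namespace Literature.NumberTheory.IwasawaTheory.UnramifiedOutsidePTowerFinite

open Literature.NumberTheory.EllipticCurves Literature.NumberTheory.EllipticCurves.GreenbergSelmer
  Literature.NumberTheory.EllipticCurves.GreenbergVatsal2000 Literature.NumberTheory.GaloisRepresentations
  Literature.NumberTheory.NumberFields Literature.NumberTheory.IwasawaTheory.ZpTowerFiniteOfLayerCardBound

variable {K : Type} [Field K] [NumberField K] {p : ℕ} [Fact p.Prime]

/-! ## §0 Helpers -/

omit [Fact p.Prime] in
/-- `unramifiedOutside H M p ∅` is stable under every `conj_σ` (it is an intersection over ALL conjugates).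
[cite: GreenbergVatsal2000, §2 p. 16] -/
theorem conjH1_mem_unramifiedOutside (H : Subgroup (absoluteGaloisGroup K)) [H.Normal]
    {M : Type} [AddCommGroup M] [DistribMulAction (absoluteGaloisGroup K) M] [TopologicalSpace M]
    [DiscreteTopology M] (σ : absoluteGaloisGroup K) {c : subgroupH1 H M}
    (hc : c ∈ unramifiedOutside H M p (∅ : Set (HeightOneSpectrum (𝓞 K)))) :
    conjH1 H M σ c ∈ unramifiedOutside H M p (∅ : Set (HeightOneSpectrum (𝓞 K))) := by
  rw [mem_unramifiedOutside_iff] at hc ⊢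
  intro v hv hvp τ
  rw [← AddMonoidHom.comp_apply, ← conjH1_mul_holds H M τ σ]
  exact hc v hv hvp (τ * σ)

/-- A maximal ideal of `\bar ℤ_K` lies above some finite place of `K`. [folklore] -/
private theorem exists_mem_primesAbove_of_isMaximal (𝔓 : Ideal (absIntegers (𝓞 K) K)) [h𝔓 : 𝔓.IsMaximal] :
    ∃ v : HeightOneSpectrum (𝓞 K), 𝔓 ∈ v.primesAbove := by
  haveI : (𝔓.under (𝓞 K)).IsMaximal := Ideal.IsMaximal.under (𝓞 K) 𝔓
  have hne : 𝔓.under (𝓞 K) ≠ ⊥ := Ring.ne_bot_of_isMaximal_of_not_isField inferInstance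
    (RingOfIntegers.not_isField K)
  exact ⟨⟨𝔓.under (𝓞 K), Ideal.IsMaximal.isPrime inferInstance, hne⟩,
    HeightOneSpectrum.mem_primesAbove_iff.mpr ⟨h𝔓.isPrime, ⟨rfl⟩⟩⟩

/-! ## §1 The tower theorem -/

/-- **Finiteness of the unramified-outside-`p` classes from layerwise CM data** (Greenberg's Lemma 5.9, generic tower
step).  See the module docstring for the statement; the layer bound handed to
`ZpTowerFiniteOfLayerCardBound.finite_of_card_fixedBy_le_pow` is obtained by extending each class fixed by `γ^{p^N}` to
`Gal(K̄/K_N)` (Greenberg's Lemma 3.2), restricting INJECTIVELY to `U_N` (index prime to `p`, trivial action), reading the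
result as a continuous homomorphism `U_N → M` that kills the inertia groups away from `p` (the class is unramified there and
those inertia groups lie in `Gal(K̄/K_∞)`, Washington Prop. 13.2), and counting such homomorphisms by the Kummer–reflection
bound at the CM extension `L_N/F_N`.
[cite: GreenbergLNM1716, §5 Lemma 5.9 (proof, pp. 142–144)] [cite: Washington1997, §13.3 and Prop. 13.2] -/
theorem finite_unramifiedOutside_of_layerData (hp2 : p ≠ 2) (κ : ZpExtension K p)
    {M : Type} [AddCommGroup M] [DistribMulAction (absoluteGaloisGroup K) M] [TopologicalSpace M]
    [DiscreteTopology M] [Finite M]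
    (hcont : ∀ m : M, Continuous fun g : absoluteGaloisGroup K => g • m) (hpM : ∀ m : M, p • m = 0)
    {k₀ : ℕ} (hcardM : Nat.card M = p ^ k₀)
    (U : ℕ → Subgroup (absoluteGaloisGroup K)) [hUn : ∀ n, (U n).Normal]
    (hUopen : ∀ n, IsOpen (U n : Set (absoluteGaloisGroup K))) (hUle : ∀ n, U n ≤ κ.layerSubgroup n)
    (hUtriv : ∀ n, ∀ σ ∈ U n, ∀ m : M, σ • m = m)
    (hUcop : ∀ n, ((U n).subgroupOf (κ.layerSubgroup n)).index.Coprime p)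
    (L : ℕ → Type) [∀ n, Field (L n)] [∀ n, NumberField (L n)] [∀ n, IsCMField (L n)]
    (eL : ∀ n, (fixedField (U n) : IntermediateField K (AlgebraicClosure K)) ≃+* maximalRealSubfield (L n))
    (ζ : ∀ n, L n) (hζ : ∀ n, IsPrimitiveRoot (ζ n) p)
    {a b n₀ : ℕ}
    (hbound : ∀ n, n₀ ≤ n →
      1 + Nat.card {v : HeightOneSpectrum (𝓞 (L n)) // ((p : ℕ) : 𝓞 (L n)) ∈ v.asIdeal} +
        padicValNat p (Nat.card ↥((powMonoidHom p : ClassGroup (𝓞 (L n)) →* ClassGroup (𝓞 (L n))).ker ⊓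
          (classGroupNorm (maximalRealSubfield (L n)) (L n)).ker)) ≤ a * n + b) :
    ((unramifiedOutside κ.kerSubgroup M p (∅ : Set (HeightOneSpectrum (𝓞 K))) :
      AddSubgroup (subgroupH1 κ.kerSubgroup M)) : Set (subgroupH1 κ.kerSubgroup M)).Finite := by
  classical
  have hpr : p.Prime := Fact.out
  obtain ⟨γ, hγ⟩ := κ.surjective (Multiplicative.ofAdd 1)
  have hγ' : κ.IsTopGenerator γ := hγ
  have hprim : ∀ m : M, ∃ k : ℕ, p ^ k • m = 0 := fun m => ⟨1, by rw [pow_one]; exact hpM m⟩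
  set S : AddSubgroup (subgroupH1 κ.kerSubgroup M) :=
    unramifiedOutside κ.kerSubgroup M p (∅ : Set (HeightOneSpectrum (𝓞 K))) with hSdef
  have hS : ∀ c ∈ S, conjH1 κ.kerSubgroup M γ c ∈ S := fun c hc => conjH1_mem_unramifiedOutside _ γ hc
  refine finite_of_card_fixedBy_le_pow κ hcont hpM hγ' S hS (a := k₀ * a) (b := k₀ * b) (n₀ := n₀) ?_
  intro N hN F hF
  -- §1 extension to the layer `K_N` (Greenberg's Lemma 3.2) and explicit cocycles
  have hex : ∀ c : subgroupH1 κ.kerSubgroup M, ∃ y : subgroupH1 (κ.layerSubgroup N) M,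
      c ∈ F → resOfLe M (κ.kerSubgroup_le_layerSubgroup N) y = c := by
    intro c
    by_cases hc : c ∈ F
    · obtain ⟨y, hy⟩ := AddMonoidHom.mem_range.1
        (ZpExtension.mem_range_resOfLe_of_conjH1_eq κ hγ' N hcont hprim c (hF c hc).2)
      exact ⟨y, fun _ => hy⟩
    · exact ⟨0, fun h => (hc h).elim⟩
  choose y hy using hex
  have hφex : ∀ c : subgroupH1 κ.kerSubgroup M,
      ∃ φ : contOneCocycles (discreteTopRep (κ.layerSubgroup N) M), oneCocycleClass _ φ = y c :=
    fun c => oneCocycleClass_surjective _ (y c)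
  choose φ hφ using hφex
  -- §2 the homomorphisms on `U_N`
  have hle : U N ≤ κ.layerSubgroup N := hUle N
  let Ψ : subgroupH1 κ.kerSubgroup M → (↥(U N) → M) := fun c u => (φ c).1 (Subgroup.inclusion hle u)
  have hΨadd : ∀ c (u v : ↥(U N)), Ψ c (u * v) = Ψ c u + Ψ c v := by
    intro c u v
    change (φ c).1 (Subgroup.inclusion hle (u * v)) = _
    rw [map_mul, (φ c).2, discreteTopRep_ρ_apply, Subgroup.smul_def]
    change (φ c).1 _ + ((u : absoluteGaloisGroup K)) • (φ c).1 _ = _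
    rw [hUtriv N _ u.2]
  have hΨcont : ∀ c, Continuous (Ψ c) := fun c =>
    (φ c).1.continuous.comp (continuous_inclusion hle)
  -- the restriction of `y c` to `U_N` is the class of the cocycle `Ψ c`
  have hres : ∀ c, resOfLe M hle (y c) = oneCocycleClass (discreteTopRep (U N) M)
      (contOneCocycles.pullback (subgroupInclusion hle)
        (resHomOfEquivariant (subgroupInclusion hle) (AddMonoidHom.id M) (fun _ _ => rfl)) (φ c)) := by
    intro c
    rw [← hφ c, resOfLe, resH1Hom_oneCocycleClass]
  -- `Ψ` is injective on `F`
  have hΨinj : Set.InjOn Ψ (F : Set (subgroupH1 κ.kerSubgroup M)) := by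
    intro c₁ hc₁ c₂ hc₂ heq
    have hinj := resOfLe_injective_of_index_coprime (M := M) hle hpr (hUcop N) hpM (hUtriv N)
    have h1 : resOfLe M hle (y c₁) = resOfLe M hle (y c₂) := by
      rw [hres, hres]
      congr 1
      apply Subtype.ext
      ext u
      rw [contOneCocycles.pullback_apply, contOneCocycles.pullback_apply]
      exact congrFun heq u
    rw [← hy c₁ hc₁, ← hy c₂ hc₂, hinj h1]
  set T : Finset (↥(U N) → M) := F.image Ψ with hT
  have hTcard : T.card = F.card := Finset.card_image_of_injOn hΨinj
  -- a common open normal subgroup killed by all members of `T`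
  obtain ⟨V, hV⟩ := UnramifiedHomsZpTowerFinite.exists_openNormalSubgroup_forall_apply_eq_zero (U N) M T
    (fun f hf => by
      obtain ⟨c, -, rfl⟩ := Finset.mem_image.1 hf
      exact hΨcont c)
    (fun f hf => by
      obtain ⟨c, -, rfl⟩ := Finset.mem_image.1 hf
      have h := hΨadd c 1 1
      rw [mul_one, left_eq_add] at h
      exact h)
  set W : Subgroup (absoluteGaloisGroup K) := (V : Subgroup (absoluteGaloisGroup K)) ⊓ U N with hW
  haveI : (V : Subgroup (absoluteGaloisGroup K)).Normal := V.isNormal'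
  haveI hWn : W.Normal := Subgroup.normal_inf_normal _ _
  have hWopen : IsOpen (W : Set (absoluteGaloisGroup K)) := V.isOpen.inter (hUopen N)
  have hWU : W ≤ U N := inf_le_right
  -- §3 the members of `T` kill the inertia groups away from `p`
  have hI0 : ∀ g ∈ T, ∀ (𝔓 : Ideal (absIntegers (𝓞 K) K)), 𝔓.IsMaximal →
      ((p : ℕ) : absIntegers (𝓞 K) K) ∉ 𝔓 →
      ∀ u : ↥(U N), (u : absoluteGaloisGroup K) ∈ 𝔓.inertia (absoluteGaloisGroup K) → g u = 0 := by
    intro g hg 𝔓 h𝔓max hp𝔓 u hu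
    obtain ⟨c, hc, rfl⟩ := Finset.mem_image.1 hg
    haveI := h𝔓max
    obtain ⟨v, hv⟩ := exists_mem_primesAbove_of_isMaximal 𝔓
    haveI : 𝔓.LiesOver v.asIdeal := (HeightOneSpectrum.mem_primesAbove_iff.mp hv).2
    have hpv : ((p : ℕ) : 𝓞 K) ∉ v.asIdeal := by
      intro hmem
      apply hp𝔓
      have h1 : ((p : ℕ) : 𝓞 K) ∈ 𝔓.under (𝓞 K) := by
        rw [← Ideal.LiesOver.over (P := 𝔓) (p := v.asIdeal)]; exact hmem
      rw [Ideal.under_def, Ideal.mem_comap, map_natCast] at h1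
      exact h1
    have hIker : 𝔓.inertia (absoluteGaloisGroup K) ≤ κ.kerSubgroup :=
      ZpExtension.inertia_le_kerSubgroup_holds K p κ hpv hv
    -- the class `c` dies on `I_𝔓 ∩ ker κ`
    have h0 := resOfLe_inertia_inf_eq_zero_of_mem_unramifiedOutside (p := p)
      (S₀ := (∅ : Set (HeightOneSpectrum (𝓞 K)))) (hF c hc).1 (Set.notMem_empty v) hpv hv
    have hle' : 𝔓.inertia (absoluteGaloisGroup K) ⊓ κ.kerSubgroup ≤ κ.layerSubgroup N :=
      inf_le_right.trans (κ.kerSubgroup_le_layerSubgroup N)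
    have h1 : resOfLe M hle' (oneCocycleClass _ (φ c)) = 0 := by
      have e : resOfLe M hle' = (resOfLe M (inf_le_right : 𝔓.inertia (absoluteGaloisGroup K) ⊓ κ.kerSubgroup ≤
          κ.kerSubgroup)).comp (resOfLe M (κ.kerSubgroup_le_layerSubgroup N)) :=
        (resOfLe_comp_holds _ _).symm
      rw [e, AddMonoidHom.comp_apply, hφ c, hy c hc, h0]
    rw [CocycleCriteria.resOfLe_oneCocycleClass_eq_zero_iff] at h1
    obtain ⟨m₀, hm₀⟩ := h1
    have h2 := hm₀ ⟨(u : absoluteGaloisGroup K), Subgroup.mem_inf.2 ⟨hu, hIker hu⟩⟩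
    have e2 : Subgroup.inclusion hle' ⟨(u : absoluteGaloisGroup K), Subgroup.mem_inf.2 ⟨hu, hIker hu⟩⟩ =
        Subgroup.inclusion hle u := Subtype.ext rfl
    change (φ c).1 (Subgroup.inclusion hle u) = 0
    rw [← e2, h2, hUtriv N _ u.2, sub_self]
  -- §4 the Kummer–reflection count at the layer `N`
  have hcount := UnramifiedOutsidePHomsKummerBound.card_le_pow_of_inertia_away p (U N) W hp2 (hUopen N) hWopen hWU
    (L N) (eL N) (hζ N) M hpM T
    (fun f hf => by
      obtain ⟨c, -, rfl⟩ := Finset.mem_image.1 hf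
      exact hΨadd c)
    (fun f hf u hu => hV _ hf u (Subgroup.mem_inf.1 hu).1)
    hI0
  have hMpos : 1 ≤ Nat.card M := Nat.card_pos
  calc F.card = T.card := hTcard.symm
    _ ≤ Nat.card M ^ (1 + Nat.card {v : HeightOneSpectrum (𝓞 (L N)) // ((p : ℕ) : 𝓞 (L N)) ∈ v.asIdeal} +
          padicValNat p (Nat.card ↥((powMonoidHom p : ClassGroup (𝓞 (L N)) →* ClassGroup (𝓞 (L N))).ker ⊓
            (classGroupNorm (maximalRealSubfield (L N)) (L N)).ker))) := hcount
    _ ≤ Nat.card M ^ (a * N + b) := Nat.pow_le_pow_right hMpos (hbound N hN)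
    _ = p ^ (k₀ * a * N + k₀ * b) := by rw [hcardM, ← pow_mul]; ring_nf

end Literature.NumberTheory.IwasawaTheory.UnramifiedOutsidePTowerFinite

end
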